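import Summits.BirchSwinnertonDyer.BirchSwinnertonDyer.Theorems.ManinLocalTwoThreeBasisSolveEighty
import Summits.BirchSwinnertonDyer.BirchSwinnertonDyer.Theorems.ManinLocalTwoThreeCurveSideFiftyTwo
import Summits.BirchSwinnertonDyer.BirchSwinnertonDyer.Theorems.ManinLocalTwoThreeNewformPinningFiftyFour
import HarnessLib

/-!
# Level 80 (C2) pinning, file 2/2: THE CURVE SIDE (four integer solutions: `80a`, `80b`, `ι₁(40a)`, `ι₁(20a)`) and THE NEWFORM OF EVERY `X₀(80)`-DATUM
# IS `80a` OR `80b` — the FRICKE SIEVE kills both old candidates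

Cell bsd-f2-manin, route `ManinLocalTwoThree` (crux C2 `ManinOddAtFour`, stmt-22967: `2² ∣ 80`), prover seat p2 gen 29; `--supports` (helper).
ABSTRACT FORM (no `η`-quotient is named here): for ANY seven cusp forms `C1, …, C7 ∈ S₂(Γ₀(80))` carrying the certified `q`-coefficient table of the
`σ`-closed `η`-basis of `…EtaTablesEighty{A,B,C}` at the thirteen columns `n ∈ {1,…,7,9,15,21,25,35,49}` (and, for the pinning, its Fricke rows
`Cᵢ ∣₂ w₈₀ = −Kᵢ·C_σ(i)`).  THE MECHANISM: (1) `dim S₂(Γ₀(80)) = g = 7`, the seven forms are independent (pivot columns `1,…,7`), and the space satisfies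
`a₉ = −a₁ − 2a₅`, `a₂₁ = −2a₁ + 2a₅`, `a₂₅ = a₁`, `a₃₅ = 2a₃ + a₇`, `a₄₉ = 3a₁ + 6a₅`; (2) on the curve (`a₂ = 0` since `2² ∣ 80`; `2, 5 ∣ N_W`, `3, 7 ∤ N_W`
from the datum; multiplicativity and the recursions at `3², 5², 7²`): `a₅² = 1`, `a₃² = 2 − 2a₅`, `a₇² = 10 + 6a₅`, `a₃a₇ = 2a₅ − 2`, whence FOUR integer
pivot vectors `(1, 0, a₃, 0, a₅, 0, a₇)` with `(a₃, a₅, a₇) ∈ {(0,1,4) = 80a, (0,1,−4) = ι₁(40a), (2,−1,−2) = 80b, (−2,−1,2) = ι₁(20a)}` — no Hasse bound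
needed; (3) THE FRICKE SIEVE (`fricke_coords`, p1 g24): `D.f` is a `w₈₀`-eigenvector, `w₈₀` is a signed scaled permutation on the `σ`-closed basis, and the two
old candidates violate row `0` resp. row `2` for both signs, while `80a`, `80b` pass with `ε = −1`.  No newness of any explicit form, no Hecke operator, no Sturm
bound, no explicit old-subspace witness.  Nothing here proves C2, Manin's conjecture or BSD. [cite: AtkinLehner1970, Lemma 7, Thm. 3, Thm. 5]
[cite: DiamondShurman2005, §5.8, §8.8 (8.44), Thm. 3.5.1] [cite: CremonaAlgorithms1997, Table 3 (N = 80)]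
-/

set_option autoImplicit false
-- lint-debt: the directory name repeats the summit name (sibling precedent `ManinLocalTwoThreeNewformPinningFortyFive.lean`)
set_option linter.dupNamespace false

noncomputable section

open Complex Filter Topology Set Function
open UpperHalfPlane hiding I
open scoped Real Topology MatrixGroups ModularForm
open ModularForm CongruenceSubgroup
open Literature.NumberTheory.ModularForms
open Literature.NumberTheory.EllipticCurves Literature.NumberTheory.EllipticCurves.ModularForms

namespace Summit.BirchSwinnertonDyer.BirchSwinnertonDyer.Theorems.ManinLocalTwoThree.LevelEighty

open NewformPinningFiftySix (dvd_conductorNorm_iff lFunction_eq_zero_of_sq_dvd)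
open LevelFortyFour (lFunction_four lFunction_mul)
open LevelFiftyTwo (lFunction_prime_sq fricke_coords)

/-! ## §2 The curve side at level 80: four integer pivot vectors, no Hasse bound -/

section CurveSide

variable (W : WeierstrassCurve ℚ) [W.IsElliptic]

/-- **The curve side of the level-80 pinning.**  For an elliptic `W/ℚ` with `2 ∣ N_W`, `5 ∣ N_W`, `3 ∤ N_W`, `7 ∤ N_W`, `a₂ = 0` (all fact-free from an `X₀(80)`-datum)
whose `aₙ` satisfy the five column relations of `S₂(Γ₀(80))`: `a₄ = a₆ = 0` and `(a₃, a₅, a₇) ∈ {(0,1,4), (0,1,−4), (2,−1,−2), (−2,−1,2)}`.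
[cite: DiamondShurman2005, §8.8 (8.44)] -/
theorem curveSide_eighty (h2N : 2 ∣ W.conductorNorm ℤ) (h5N : 5 ∣ W.conductorNorm ℤ) (h3N : ¬ 3 ∣ W.conductorNorm ℤ) (h7N : ¬ 7 ∣ W.conductorNorm ℤ)
    (ha2 : W.LFunction 2 = 0)
    (r9 : W.LFunction 9 = -W.LFunction 1 - 2 * W.LFunction 5)
    (r21 : W.LFunction 21 = -2 * W.LFunction 1 + 2 * W.LFunction 5)
    (r25 : W.LFunction 25 = W.LFunction 1)
    (r35 : W.LFunction 35 = 2 * W.LFunction 3 + W.LFunction 7)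
    (r49 : W.LFunction 49 = 3 * W.LFunction 1 + 6 * W.LFunction 5) :
    W.LFunction 1 = 1 ∧ W.LFunction 2 = 0 ∧ W.LFunction 4 = 0 ∧ W.LFunction 6 = 0 ∧
      ((W.LFunction 3 = 0 ∧ W.LFunction 5 = 1 ∧ W.LFunction 7 = 4) ∨ (W.LFunction 3 = 0 ∧ W.LFunction 5 = 1 ∧ W.LFunction 7 = -4) ∨
       (W.LFunction 3 = 2 ∧ W.LFunction 5 = -1 ∧ W.LFunction 7 = -2) ∨ (W.LFunction 3 = -2 ∧ W.LFunction 5 = -1 ∧ W.LFunction 7 = 2)) := by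
  have a1 : W.LFunction 1 = 1 := WeierstrassCurve.LFunction_apply_one W
  have a4 : W.LFunction 4 = W.LFunction 2 * W.LFunction 2 := by
    have h := lFunction_four W; rw [if_pos h2N, sub_zero] at h; exact h
  have a6 : W.LFunction 6 = W.LFunction 2 * W.LFunction 3 := lFunction_mul W (show Nat.Coprime 2 3 by norm_num)
  have a9 : W.LFunction 9 = W.LFunction 3 * W.LFunction 3 - 3 := by
    have h := lFunction_prime_sq W Nat.prime_three; rw [if_neg h3N] at h; exact_mod_cast h
  have a25 : W.LFunction 25 = W.LFunction 5 * W.LFunction 5 := by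
    have h := lFunction_prime_sq W (show Nat.Prime 5 by norm_num); rw [if_pos h5N, sub_zero] at h; exact h
  have a49 : W.LFunction 49 = W.LFunction 7 * W.LFunction 7 - 7 := by
    have h := lFunction_prime_sq W (show Nat.Prime 7 by norm_num); rw [if_neg h7N] at h; exact_mod_cast h
  have a21 : W.LFunction 21 = W.LFunction 3 * W.LFunction 7 := lFunction_mul W (show Nat.Coprime 3 7 by norm_num)
  have a35 : W.LFunction 35 = W.LFunction 5 * W.LFunction 7 := lFunction_mul W (show Nat.Coprime 5 7 by norm_num)
  rw [ha2, mul_zero] at a4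
  rw [ha2, zero_mul] at a6
  generalize hs : W.LFunction 3 = s at *
  generalize hr : W.LFunction 5 = r at *
  generalize hq : W.LFunction 7 = q at *
  rw [a1] at r9 r21 r25 r49
  have hr2 : (r - 1) * (r + 1) = 0 := by nlinarith [r25, a25]
  rcases mul_eq_zero.mp hr2 with hr1 | hr1
  · have hr' : r = 1 := by linarith
    subst hr'
    have hs0 : s = 0 := by nlinarith [r9, a9]
    subst hs0
    have hq2 : (q - 4) * (q + 4) = 0 := by nlinarith [r49, a49]
    rcases mul_eq_zero.mp hq2 with hq1 | hq1
    · have hq' : q = 4 := by linarith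
      subst hq'
      exact ⟨a1, ha2, a4, a6, Or.inl ⟨rfl, rfl, rfl⟩⟩
    · have hq' : q = -4 := by linarith
      subst hq'
      exact ⟨a1, ha2, a4, a6, Or.inr (Or.inl ⟨rfl, rfl, rfl⟩)⟩
  · have hr' : r = -1 := by linarith
    subst hr'
    have hs2 : (s - 2) * (s + 2) = 0 := by nlinarith [r9, a9]
    rcases mul_eq_zero.mp hs2 with hs1 | hs1
    · have hs' : s = 2 := by linarith
      subst hs'
      have hq' : q = -2 := by nlinarith [r21, a21]
      subst hq'
      exact ⟨a1, ha2, a4, a6, Or.inr (Or.inr (Or.inl ⟨rfl, rfl, rfl⟩))⟩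
    · have hs' : s = -2 := by linarith
      subst hs'
      have hq' : q = 2 := by nlinarith [r21, a21]
      subst hq'
      exact ⟨a1, ha2, a4, a6, Or.inr (Or.inr (Or.inr ⟨rfl, rfl, rfl⟩))⟩

end CurveSide

/-! ## §3 The pinning: coordinates of the four candidates, the Fricke sieve, the conclusion -/

section Pinning

variable {C1 C2 C3 C4 C5 C6 C7 : CuspForm (Gamma0 80) 2}
  (h1 : cuspCoeff C1 1 = (0 : ℂ) ∧ cuspCoeff C1 2 = (0 : ℂ) ∧ cuspCoeff C1 3 = (0 : ℂ) ∧ cuspCoeff C1 4 = (0 : ℂ) ∧ cuspCoeff C1 5 = (0 : ℂ) ∧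
      cuspCoeff C1 6 = (0 : ℂ) ∧ cuspCoeff C1 7 = (1 : ℂ) ∧ cuspCoeff C1 9 = (0 : ℂ) ∧ cuspCoeff C1 15 = (0 : ℂ) ∧ cuspCoeff C1 21 = (0 : ℂ) ∧
      cuspCoeff C1 25 = (0 : ℂ) ∧ cuspCoeff C1 35 = (1 : ℂ) ∧ cuspCoeff C1 49 = (0 : ℂ))
  (h2 : cuspCoeff C2 1 = (1 : ℂ) ∧ cuspCoeff C2 2 = (-2 : ℂ) ∧ cuspCoeff C2 3 = (0 : ℂ) ∧ cuspCoeff C2 4 = (0 : ℂ) ∧ cuspCoeff C2 5 = (1 : ℂ) ∧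
      cuspCoeff C2 6 = (0 : ℂ) ∧ cuspCoeff C2 7 = (4 : ℂ) ∧ cuspCoeff C2 9 = (-3 : ℂ) ∧ cuspCoeff C2 15 = (0 : ℂ) ∧ cuspCoeff C2 21 = (0 : ℂ) ∧
      cuspCoeff C2 25 = (1 : ℂ) ∧ cuspCoeff C2 35 = (4 : ℂ) ∧ cuspCoeff C2 49 = (9 : ℂ))
  (h3 : cuspCoeff C3 1 = (0 : ℂ) ∧ cuspCoeff C3 2 = (0 : ℂ) ∧ cuspCoeff C3 3 = (0 : ℂ) ∧ cuspCoeff C3 4 = (1 : ℂ) ∧ cuspCoeff C3 5 = (0 : ℂ) ∧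
      cuspCoeff C3 6 = (0 : ℂ) ∧ cuspCoeff C3 7 = (0 : ℂ) ∧ cuspCoeff C3 9 = (0 : ℂ) ∧ cuspCoeff C3 15 = (0 : ℂ) ∧ cuspCoeff C3 21 = (0 : ℂ) ∧
      cuspCoeff C3 25 = (0 : ℂ) ∧ cuspCoeff C3 35 = (0 : ℂ) ∧ cuspCoeff C3 49 = (0 : ℂ))
  (h4 : cuspCoeff C4 1 = (1 : ℂ) ∧ cuspCoeff C4 2 = (0 : ℂ) ∧ cuspCoeff C4 3 = (-2 : ℂ) ∧ cuspCoeff C4 4 = (0 : ℂ) ∧ cuspCoeff C4 5 = (-1 : ℂ) ∧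
      cuspCoeff C4 6 = (0 : ℂ) ∧ cuspCoeff C4 7 = (2 : ℂ) ∧ cuspCoeff C4 9 = (1 : ℂ) ∧ cuspCoeff C4 15 = (2 : ℂ) ∧ cuspCoeff C4 21 = (-4 : ℂ) ∧
      cuspCoeff C4 25 = (1 : ℂ) ∧ cuspCoeff C4 35 = (-2 : ℂ) ∧ cuspCoeff C4 49 = (-3 : ℂ))
  (h5 : cuspCoeff C5 1 = (1 : ℂ) ∧ cuspCoeff C5 2 = (0 : ℂ) ∧ cuspCoeff C5 3 = (1 : ℂ) ∧ cuspCoeff C5 4 = (0 : ℂ) ∧ cuspCoeff C5 5 = (0 : ℂ) ∧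
      cuspCoeff C5 6 = (0 : ℂ) ∧ cuspCoeff C5 7 = (1 : ℂ) ∧ cuspCoeff C5 9 = (-1 : ℂ) ∧ cuspCoeff C5 15 = (-1 : ℂ) ∧ cuspCoeff C5 21 = (-2 : ℂ) ∧
      cuspCoeff C5 25 = (1 : ℂ) ∧ cuspCoeff C5 35 = (3 : ℂ) ∧ cuspCoeff C5 49 = (3 : ℂ))
  (h6 : cuspCoeff C6 1 = (0 : ℂ) ∧ cuspCoeff C6 2 = (1 : ℂ) ∧ cuspCoeff C6 3 = (0 : ℂ) ∧ cuspCoeff C6 4 = (0 : ℂ) ∧ cuspCoeff C6 5 = (0 : ℂ) ∧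
      cuspCoeff C6 6 = (-1 : ℂ) ∧ cuspCoeff C6 7 = (-2 : ℂ) ∧ cuspCoeff C6 9 = (0 : ℂ) ∧ cuspCoeff C6 15 = (0 : ℂ) ∧ cuspCoeff C6 21 = (0 : ℂ) ∧
      cuspCoeff C6 25 = (0 : ℂ) ∧ cuspCoeff C6 35 = (-2 : ℂ) ∧ cuspCoeff C6 49 = (0 : ℂ))
  (h7 : cuspCoeff C7 1 = (0 : ℂ) ∧ cuspCoeff C7 2 = (1 : ℂ) ∧ cuspCoeff C7 3 = (0 : ℂ) ∧ cuspCoeff C7 4 = (0 : ℂ) ∧ cuspCoeff C7 5 = (0 : ℂ) ∧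
      cuspCoeff C7 6 = (-2 : ℂ) ∧ cuspCoeff C7 7 = (0 : ℂ) ∧ cuspCoeff C7 9 = (0 : ℂ) ∧ cuspCoeff C7 15 = (0 : ℂ) ∧ cuspCoeff C7 21 = (0 : ℂ) ∧
      cuspCoeff C7 25 = (0 : ℂ) ∧ cuspCoeff C7 35 = (0 : ℂ) ∧ cuspCoeff C7 49 = (0 : ℂ))
include h1 h2 h3 h4 h5 h6 h7

/-- **THE NEWFORM OF EVERY `X₀(80)`-DATUM IS `80a = Σ xᵢCᵢ` OR `80b = Σ yᵢCᵢ`** on any seven cusp forms of `S₂(Γ₀(80))` with the certified columns and Fricke rows of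
the `σ`-closed `η`-basis — FACT-FREE (linear algebra + curve recursion + the FRICKE SIEVE against `ι₁(40a)`, `ι₁(20a)`). [cite: AtkinLehner1970, Thm. 3, Thm. 5]
[cite: DiamondShurman2005, Thm. 3.5.1, §5.8] [cite: CremonaAlgorithms1997, Table 3 (N = 80)] -/
theorem f_eq_eighty_of_basis {W : WeierstrassCurve ℚ} [W.IsElliptic] (D : ModularParametrizationData W 80)
    (w1 : (⇑C1 : ℍ → ℂ) ∣[(2 : ℤ)] (glCast (frickeGL 80 : GL (Fin 2) ℚ) : GL (Fin 2) ℝ) = (((-1 : ℂ) / 8)) • (⇑C2 : ℍ → ℂ))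
    (w2 : (⇑C2 : ℍ → ℂ) ∣[(2 : ℤ)] (glCast (frickeGL 80 : GL (Fin 2) ℚ) : GL (Fin 2) ℝ) = ((-8 : ℂ)) • (⇑C1 : ℍ → ℂ))
    (w3 : (⇑C3 : ℍ → ℂ) ∣[(2 : ℤ)] (glCast (frickeGL 80 : GL (Fin 2) ℚ) : GL (Fin 2) ℝ) = (((-1 : ℂ) / 4)) • (⇑C4 : ℍ → ℂ))
    (w4 : (⇑C4 : ℍ → ℂ) ∣[(2 : ℤ)] (glCast (frickeGL 80 : GL (Fin 2) ℚ) : GL (Fin 2) ℝ) = ((-4 : ℂ)) • (⇑C3 : ℍ → ℂ))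
    (w5 : (⇑C5 : ℍ → ℂ) ∣[(2 : ℤ)] (glCast (frickeGL 80 : GL (Fin 2) ℚ) : GL (Fin 2) ℝ) = ((-1 : ℂ)) • (⇑C5 : ℍ → ℂ))
    (w6 : (⇑C6 : ℍ → ℂ) ∣[(2 : ℤ)] (glCast (frickeGL 80 : GL (Fin 2) ℚ) : GL (Fin 2) ℝ) = ((-1 : ℂ)) • (⇑C6 : ℍ → ℂ))
    (w7 : (⇑C7 : ℍ → ℂ) ∣[(2 : ℤ)] (glCast (frickeGL 80 : GL (Fin 2) ℚ) : GL (Fin 2) ℝ) = ((-1 : ℂ)) • (⇑C7 : ℍ → ℂ)) :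
    D.f = ∑ i, ![(8 : ℂ), (1 : ℂ), (0 : ℂ), (0 : ℂ), (0 : ℂ), (4 : ℂ), (-2 : ℂ)] i • ![C1, C2, C3, C4, C5, C6, C7] i ∨ D.f = ∑ i, ![(-8 : ℂ), (-1 : ℂ), (0 : ℂ), (0 : ℂ), (2 : ℂ), (-4 : ℂ), (2 : ℂ)] i • ![C1, C2, C3, C4, C5, C6, C7] i := by
  have hF : ∀ n, cuspCoeff D.f n = (W.LFunction n : ℂ) := fun n ↦ D.isNewformOf.2 n
  obtain ⟨c, hc⟩ := exists_coords80 h1 h2 h3 h4 h5 h6 h7 D.f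
  obtain ⟨q9, q21, q25, q35, q49⟩ := columnRelations80 h1 h2 h3 h4 h5 h6 h7 D.f
  simp only [hF] at q9 q21 q25 q35 q49
  have r9 : W.LFunction 9 = -W.LFunction 1 - 2 * W.LFunction 5 := by exact_mod_cast q9
  have r21 : W.LFunction 21 = -2 * W.LFunction 1 + 2 * W.LFunction 5 := by exact_mod_cast q21
  have r25 : W.LFunction 25 = W.LFunction 1 := by exact_mod_cast q25
  have r35 : W.LFunction 35 = 2 * W.LFunction 3 + W.LFunction 7 := by exact_mod_cast q35
  have r49 : W.LFunction 49 = 3 * W.LFunction 1 + 6 * W.LFunction 5 := by exact_mod_cast q49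
  have h2N : 2 ∣ W.conductorNorm ℤ := (dvd_conductorNorm_iff D Nat.prime_two).mpr (by norm_num)
  have h5N : 5 ∣ W.conductorNorm ℤ := (dvd_conductorNorm_iff D (by norm_num : Nat.Prime 5)).mpr (by norm_num)
  have h3N : ¬ 3 ∣ W.conductorNorm ℤ := fun h ↦ absurd ((dvd_conductorNorm_iff D Nat.prime_three).mp h) (by norm_num)
  have h7N : ¬ 7 ∣ W.conductorNorm ℤ := fun h ↦ absurd ((dvd_conductorNorm_iff D (by norm_num : Nat.Prime 7)).mp h) (by norm_num)
  have ha2 : W.LFunction 2 = 0 := lFunction_eq_zero_of_sq_dvd D Nat.prime_two (by norm_num)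
  obtain ⟨a1, a2, a4, a6, hcase⟩ := curveSide_eighty W h2N h5N h3N h7N ha2 r9 r21 r25 r35 r49
  obtain ⟨pa1, pa2, pa3, pa4, pa5, pa6, pa7⟩ := coeff_pivots_eightyA h1 h2 h3 h4 h5 h6 h7
  obtain ⟨pb1, pb2, pb3, pb4, pb5, pb6, pb7⟩ := coeff_pivots_eightyB h1 h2 h3 h4 h5 h6 h7
  obtain ⟨po1, po2, po3, po4, po5, po6, po7⟩ := coeff_pivots_old40 h1 h2 h3 h4 h5 h6 h7
  obtain ⟨pt1, pt2, pt3, pt4, pt5, pt6, pt7⟩ := coeff_pivots_old20 h1 h2 h3 h4 h5 h6 h7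
  -- linear independence of the coerced family and its Fricke rows (used by the two old cases)
  have hLI : LinearIndependent ℂ (fun i ↦ (⇑(![C1, C2, C3, C4, C5, C6, C7] i) : ℍ → ℂ)) := by
    rw [Fintype.linearIndependent_iff]
    intro d hd
    have h0 : (∑ i, d i • ![C1, C2, C3, C4, C5, C6, C7] i) = 0 := by
      apply DFunLike.coe_injective
      rw [coe_sum_smul80]
      simpa using hd
    exact Fintype.linearIndependent_iff.mp (linearIndependent80 h1 h2 h3 h4 h5 h6 h7) d h0
  have hW : ∀ i : Fin 7, (fun i ↦ (⇑(![C1, C2, C3, C4, C5, C6, C7] i) : ℍ → ℂ)) i ∣[(2 : ℤ)] (glCast (frickeGL 80 : GL (Fin 2) ℚ) : GL (Fin 2) ℝ)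
      = ∑ j, (![![(0 : ℂ), (-8 : ℂ), (0 : ℂ), (0 : ℂ), (0 : ℂ), (0 : ℂ), (0 : ℂ)],
      ![((-1 : ℂ) / 8), (0 : ℂ), (0 : ℂ), (0 : ℂ), (0 : ℂ), (0 : ℂ), (0 : ℂ)],
      ![(0 : ℂ), (0 : ℂ), (0 : ℂ), (-4 : ℂ), (0 : ℂ), (0 : ℂ), (0 : ℂ)],
      ![(0 : ℂ), (0 : ℂ), ((-1 : ℂ) / 4), (0 : ℂ), (0 : ℂ), (0 : ℂ), (0 : ℂ)],
      ![(0 : ℂ), (0 : ℂ), (0 : ℂ), (0 : ℂ), (-1 : ℂ), (0 : ℂ), (0 : ℂ)],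
      ![(0 : ℂ), (0 : ℂ), (0 : ℂ), (0 : ℂ), (0 : ℂ), (-1 : ℂ), (0 : ℂ)],
      ![(0 : ℂ), (0 : ℂ), (0 : ℂ), (0 : ℂ), (0 : ℂ), (0 : ℂ), (-1 : ℂ)]] : Fin 7 → Fin 7 → ℂ) j i • (fun i ↦ (⇑(![C1, C2, C3, C4, C5, C6, C7] i) : ℍ → ℂ)) j := by
    intro i
    fin_cases i <;>
      simp only [Fin.sum_univ_succ, Fin.sum_univ_zero, Matrix.cons_val_zero, Matrix.cons_val_succ, Matrix.cons_val, Fin.isValue,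
        Fin.zero_eta, Fin.mk_one, Fin.reduceFinMk, zero_smul, add_zero, zero_add, w1, w2, w3, w4, w5, w6, w7]
  rcases hcase with ⟨a3, a5, a7⟩ | ⟨a3, a5, a7⟩ | ⟨a3, a5, a7⟩ | ⟨a3, a5, a7⟩
  · -- `80a`
    left
    refine (hc.trans (eq_of_pivots80 h1 h2 h3 h4 h5 h6 h7 c _ fun n hn ↦ ?_))
    rw [← hc]
    simp only [Finset.mem_insert, Finset.mem_singleton] at hn
    rcases hn with rfl | rfl | rfl | rfl | rfl | rfl | rfl
    · rw [hF, pa1, a1]; norm_num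
    · rw [hF, pa2, a2]; norm_num
    · rw [hF, pa3, a3]; norm_num
    · rw [hF, pa4, a4]; norm_num
    · rw [hF, pa5, a5]; norm_num
    · rw [hF, pa6, a6]; norm_num
    · rw [hF, pa7, a7]; norm_num
  · -- `ι₁(40a)`: coordinates, then the Fricke sieve (row 0)
    have hold : D.f = ∑ i, ![(0 : ℂ), (1 : ℂ), (0 : ℂ), (0 : ℂ), (0 : ℂ), (4 : ℂ), (-2 : ℂ)] i • ![C1, C2, C3, C4, C5, C6, C7] i := by
      refine (hc.trans (eq_of_pivots80 h1 h2 h3 h4 h5 h6 h7 c _ fun n hn ↦ ?_))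
      rw [← hc]
      simp only [Finset.mem_insert, Finset.mem_singleton] at hn
      rcases hn with rfl | rfl | rfl | rfl | rfl | rfl | rfl
      · rw [hF, po1, a1]; norm_num
      · rw [hF, po2, a2]; norm_num
      · rw [hF, po3, a3]; norm_num
      · rw [hF, po4, a4]; norm_num
      · rw [hF, po5, a5]; norm_num
      · rw [hF, po6, a6]; norm_num
      · rw [hF, po7, a7]; norm_num
    exfalso
    have hfun : (⇑D.f : ℍ → ℂ) = ∑ i, ![(0 : ℂ), (1 : ℂ), (0 : ℂ), (0 : ℂ), (0 : ℂ), (4 : ℂ), (-2 : ℂ)] i • (fun i ↦ (⇑(![C1, C2, C3, C4, C5, C6, C7] i) : ℍ → ℂ)) i := by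
      have h := congrArg (fun H : CuspForm (Gamma0 80) 2 ↦ (⇑H : ℍ → ℂ)) hold
      simp only [coe_sum_smul80] at h
      exact h
    obtain ⟨ε, hε, hrow⟩ := fricke_coords D (fun i ↦ (⇑(![C1, C2, C3, C4, C5, C6, C7] i) : ℍ → ℂ)) hLI (![(0 : ℂ), (1 : ℂ), (0 : ℂ), (0 : ℂ), (0 : ℂ), (4 : ℂ), (-2 : ℂ)]) hfun (![![(0 : ℂ), (-8 : ℂ), (0 : ℂ), (0 : ℂ), (0 : ℂ), (0 : ℂ), (0 : ℂ)],
      ![((-1 : ℂ) / 8), (0 : ℂ), (0 : ℂ), (0 : ℂ), (0 : ℂ), (0 : ℂ), (0 : ℂ)],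
      ![(0 : ℂ), (0 : ℂ), (0 : ℂ), (-4 : ℂ), (0 : ℂ), (0 : ℂ), (0 : ℂ)],
      ![(0 : ℂ), (0 : ℂ), ((-1 : ℂ) / 4), (0 : ℂ), (0 : ℂ), (0 : ℂ), (0 : ℂ)],
      ![(0 : ℂ), (0 : ℂ), (0 : ℂ), (0 : ℂ), (-1 : ℂ), (0 : ℂ), (0 : ℂ)],
      ![(0 : ℂ), (0 : ℂ), (0 : ℂ), (0 : ℂ), (0 : ℂ), (-1 : ℂ), (0 : ℂ)],
      ![(0 : ℂ), (0 : ℂ), (0 : ℂ), (0 : ℂ), (0 : ℂ), (0 : ℂ), (-1 : ℂ)]]) hW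
    have e0 := hrow 0
    simp only [Fin.sum_univ_succ, Fin.sum_univ_zero, Matrix.cons_val_zero, Matrix.cons_val_succ, Fin.isValue] at e0
    rcases hε with rfl | rfl
    · norm_num at e0
    · norm_num at e0
  · -- `80b`
    right
    refine (hc.trans (eq_of_pivots80 h1 h2 h3 h4 h5 h6 h7 c _ fun n hn ↦ ?_))
    rw [← hc]
    simp only [Finset.mem_insert, Finset.mem_singleton] at hn
    rcases hn with rfl | rfl | rfl | rfl | rfl | rfl | rfl
    · rw [hF, pb1, a1]; norm_num
    · rw [hF, pb2, a2]; norm_num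
    · rw [hF, pb3, a3]; norm_num
    · rw [hF, pb4, a4]; norm_num
    · rw [hF, pb5, a5]; norm_num
    · rw [hF, pb6, a6]; norm_num
    · rw [hF, pb7, a7]; norm_num
  · -- `ι₁(20a) = C4`: the Fricke sieve (row 2)
    have hold : D.f = ∑ i, ![(0 : ℂ), (0 : ℂ), (0 : ℂ), (1 : ℂ), (0 : ℂ), (0 : ℂ), (0 : ℂ)] i • ![C1, C2, C3, C4, C5, C6, C7] i := by
      refine (hc.trans (eq_of_pivots80 h1 h2 h3 h4 h5 h6 h7 c _ fun n hn ↦ ?_))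
      rw [← hc]
      simp only [Finset.mem_insert, Finset.mem_singleton] at hn
      rcases hn with rfl | rfl | rfl | rfl | rfl | rfl | rfl
      · rw [hF, pt1, a1]; norm_num
      · rw [hF, pt2, a2]; norm_num
      · rw [hF, pt3, a3]; norm_num
      · rw [hF, pt4, a4]; norm_num
      · rw [hF, pt5, a5]; norm_num
      · rw [hF, pt6, a6]; norm_num
      · rw [hF, pt7, a7]; norm_num
    exfalso
    have hfun : (⇑D.f : ℍ → ℂ) = ∑ i, ![(0 : ℂ), (0 : ℂ), (0 : ℂ), (1 : ℂ), (0 : ℂ), (0 : ℂ), (0 : ℂ)] i • (fun i ↦ (⇑(![C1, C2, C3, C4, C5, C6, C7] i) : ℍ → ℂ)) i := by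
      have h := congrArg (fun H : CuspForm (Gamma0 80) 2 ↦ (⇑H : ℍ → ℂ)) hold
      simp only [coe_sum_smul80] at h
      exact h
    obtain ⟨ε, hε, hrow⟩ := fricke_coords D (fun i ↦ (⇑(![C1, C2, C3, C4, C5, C6, C7] i) : ℍ → ℂ)) hLI (![(0 : ℂ), (0 : ℂ), (0 : ℂ), (1 : ℂ), (0 : ℂ), (0 : ℂ), (0 : ℂ)]) hfun (![![(0 : ℂ), (-8 : ℂ), (0 : ℂ), (0 : ℂ), (0 : ℂ), (0 : ℂ), (0 : ℂ)],
      ![((-1 : ℂ) / 8), (0 : ℂ), (0 : ℂ), (0 : ℂ), (0 : ℂ), (0 : ℂ), (0 : ℂ)],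
      ![(0 : ℂ), (0 : ℂ), (0 : ℂ), (-4 : ℂ), (0 : ℂ), (0 : ℂ), (0 : ℂ)],
      ![(0 : ℂ), (0 : ℂ), ((-1 : ℂ) / 4), (0 : ℂ), (0 : ℂ), (0 : ℂ), (0 : ℂ)],
      ![(0 : ℂ), (0 : ℂ), (0 : ℂ), (0 : ℂ), (-1 : ℂ), (0 : ℂ), (0 : ℂ)],
      ![(0 : ℂ), (0 : ℂ), (0 : ℂ), (0 : ℂ), (0 : ℂ), (-1 : ℂ), (0 : ℂ)],
      ![(0 : ℂ), (0 : ℂ), (0 : ℂ), (0 : ℂ), (0 : ℂ), (0 : ℂ), (-1 : ℂ)]]) hW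
    have e0 := hrow 2
    simp only [Fin.sum_univ_succ, Fin.sum_univ_zero, Matrix.cons_val_zero, Matrix.cons_val_succ, Matrix.cons_val, Fin.isValue] at e0
    rcases hε with rfl | rfl
    · norm_num at e0
    · norm_num at e0

end Pinning

end Summit.BirchSwinnertonDyer.BirchSwinnertonDyer.Theorems.ManinLocalTwoThree.LevelEighty

end
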